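/-
# STUB_IDEAS — `stub_liftThree` — ideator k1 (FAMILY 1) — GEN 7 companion
Crux `FreyModularity` (stmt-ABC-11340), skeleton `Cruxes/FreyModularity/Lines/Sketch.lean`
(sha 21576c53…), stub `stub_liftThree` = CDT 1999 Thm 7.2.1 at `p = 3`, `9 ∤ N`.

WHAT THIS FILE TYPES (helper signatures for Plan 3 of `STUB-IDEAS-stub_liftThree-1.md`, gen 7):
the bricks of **DDT 1995 Lemma 3.27** — the representation `ρ^mod_Σ : G_ℚ → GL₂(T_Σ)` with
`tr ρ^mod_Σ(Frob_r) = T_r` — over the tree's ALGEBRAIC Hecke algebra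
`Literature.NumberTheory.Automorphic.heckeAlgebraOfTypeSigma` (whose docstring lists `ρ^mod_Σ`
under "NOT HERE") and the 2026-08-30 modules `WilesPseudoRepresentation{,Gluing,AdaptedBasis}`
(Wiles 1988 §2.2 / Hida MFG Prop. 2.16, Lemma 3.28).  Proof in print: DDT p. 95 ("choose complex
conjugation `c` … by continuity and Chebotarev `tr ρ̃ ∈ T_Σ` … by irreducibility of `ρ̄` some
`e = b(r)c(s)` is a unit … rescale"), i.e. exactly adapted basis + gluing by traces + `toGL`.

* `sigG0`  (PROVED): closed `T_Σ` + dense good Frobenii ⇒ every trace tuple `T_σ ∈ T_Σ`.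
* `SigG1`  (S/M): odd `ρ`, `2 ∈ O×`, `O` local ⇒ a Wiles pseudo-representation `Π` of `(G_ℚ, c)`
           over `T_Σ` with `Tr Π = (T_σ)_σ` — `WilesPseudoRep.ofTraceFamily` over the coordinate
           maps + `WilesPseudoRep.exists_of_rep` per coordinate.
* `sigG2a` (PROVED): for `t ∈ T_Σ` every `Ō`-coordinate is `≡ π_f(t)` mod `𝔪_Ō`.
* `SigG2b` (PROVED as `sigG2b`): `O` local + `T_Σ` inverse-closed in `T̃_Σ` ⇒ `T_Σ` local, `π_f` local hom.
* `SigG3`  (S/M): residual absolute irreducibility ⇒ some `x(r,s) = b(r)c(s)` is a unit.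
* `SigG4`  (S, assembly of G0–G3 via `WilesPseudoRep.toGL`): `ρ^mod_Σ` exists, odd-normalised,
           with the prescribed traces (DDT Lemma 3.27, representation clause).
Hypotheses kept EXPLICIT because they are false for the literal (infinite) index set `N_Σ(Ō)`
without the finiteness input (Carayol–Livné / DDT "finitely generated free `O`-module"):
`IsClosed T_Σ`, inverse-closedness of `T_Σ ⊆ T̃_Σ`.
-/
import Literature.NumberTheory.Automorphic.HeckeAlgebraOfTypeSigma
import Literature.NumberTheory.GaloisRepresentations.WilesPseudoRepresentationGluing
import Literature.NumberTheory.GaloisRepresentations.WilesPseudoRepresentationAdaptedBasis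
import Literature.NumberTheory.GaloisRepresentations.ResidualGaloisRep
import HarnessLib

noncomputable section

open scoped NumberField MatrixGroups
open Field IsDedekindDomain IsLocalRing

namespace Summit.ABC.ABC.Cruxes.FreyModularity.Sketch.StubIdeas1g7

open Literature.NumberTheory.Automorphic Literature.NumberTheory.GaloisRepresentations

universe u v u' v'

variable (p : ℕ) (k : ℤ) {O : Type u} [CommRing O] [TopologicalSpace O]
  (Ō : Type v) [CommRing Ō] [IsLocalRing Ō] [TopologicalSpace Ō] [Algebra O Ō]
  (ρ : FramedGaloisRep ℚ O 2) (S : Set ℕ)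

/-! ### G0 — "by continuity and the Chebotarev density theorem `tr ρ̃ ∈ T_Σ`" (DDT p. 95) -/

/-- The trace-tuple map `σ ↦ T_σ ∈ T̃_Σ = O × ∏ Ō` is continuous. [folklore] -/
theorem continuous_traceTuple [IsTopologicalRing O] [IsTopologicalRing Ō] :
    Continuous (traceTuple p k Ō ρ S) :=
  (FramedRep.continuous_trace ρ).prodMk
    (continuous_pi fun ρ' => FramedRep.continuous_trace (ρ' : FramedGaloisRep ℚ Ō 2))

/-- **G0.** If `T_Σ` is closed in `T̃_Σ` (in print: `T_Σ` is a finite free `O`-module, `O` compact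
— DDT §3.3 p. 94) and the good Frobenius elements are dense in `G_ℚ` (Chebotarev:
`absoluteGaloisGroup.frobenius_dense`), then EVERY trace tuple `T_σ` lies in `T_Σ`.
[cite: DarmonDiamondTaylor1995, Lemma 3.27 (proof, p. 95)] -/
theorem sigG0 [IsTopologicalRing O] [IsTopologicalRing Ō]
    (hclosed : IsClosed ((heckeAlgebraOfTypeSigma p k Ō ρ S :
        Subalgebra O (O × (modularLiftsOfTypeSigma p k Ō ρ S → Ō))) :
      Set (O × (modularLiftsOfTypeSigma p k Ō ρ S → Ō))))
    (hdense : Dense {σ : absoluteGaloisGroup ℚ | IsGoodFrobenius p ρ S σ})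
    (σ : absoluteGaloisGroup ℚ) :
    traceTuple p k Ō ρ S σ ∈ heckeAlgebraOfTypeSigma p k Ō ρ S := by
  have hsub : {σ : absoluteGaloisGroup ℚ | IsGoodFrobenius p ρ S σ} ⊆
      traceTuple p k Ō ρ S ⁻¹'
        ((heckeAlgebraOfTypeSigma p k Ō ρ S :
          Subalgebra O (O × (modularLiftsOfTypeSigma p k Ō ρ S → Ō))) :
          Set (O × (modularLiftsOfTypeSigma p k Ō ρ S → Ō))) :=
    fun τ hτ => traceTuple_mem hτ
  have hcl : IsClosed (traceTuple p k Ō ρ S ⁻¹'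
        ((heckeAlgebraOfTypeSigma p k Ō ρ S :
          Subalgebra O (O × (modularLiftsOfTypeSigma p k Ō ρ S → Ō))) :
          Set (O × (modularLiftsOfTypeSigma p k Ō ρ S → Ō)))) :=
    hclosed.preimage (continuous_traceTuple p k Ō ρ S)
  have huniv := hdense.closure_eq
  have hmem : σ ∈ closure {σ : absoluteGaloisGroup ℚ | IsGoodFrobenius p ρ S σ} := by
    rw [huniv]; exact Set.mem_univ σ
  exact hcl.closure_subset_iff.mpr hsub hmem

/-! ### G1 — gluing the coordinate pseudo-representations by their traces (Hida Lemma 3.28) -/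

/-- **G1 (helper signature).** For `O` local with `2 ∈ O×`, `ρ` odd and `c` a complex
conjugation, if all trace tuples lie in `T_Σ` (G0) then there is a Wiles pseudo-representation
`Π` of `(G_ℚ, c)` over `T_Σ` whose trace function is `σ ↦ T_σ`.  Route: index the coordinates of
`T̃_Σ = O × ∏_{N_Σ} Ō` by `Option N_Σ`; the coordinate ring maps `T_Σ → O` (`π_f`) and
`T_Σ → Ō` (`ρ'`-evaluation) are jointly injective; each coordinate representation (`ρ`, resp.
`ρ' ∈ N_Σ`, with `det(c) = -1` by oddness and the fixed-determinant clause (iii)) has an adapted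
pseudo-representation with the same trace (`WilesPseudoRep.exists_of_rep`, local rings, `2` a
unit); glue with `WilesPseudoRep.ofTraceFamily` (`u = ⅟2`), trace by `tr_ofTraceFamily`.
[cite: DarmonDiamondTaylor1995, Lemma 3.27 (proof, p. 95)] [cite: Hida2000, Lemma 3.28 (pp. 158–159)] -/
def SigG1 [IsLocalRing O] : Prop :=
  IsUnit (2 : O) → ∀ (φ : ℚ →+* ℝ) (c : absoluteGaloisGroup ℚ), IsComplexConjugation φ c →
    ρ.IsOdd →
    (∀ σ : absoluteGaloisGroup ℚ, traceTuple p k Ō ρ S σ ∈ heckeAlgebraOfTypeSigma p k Ō ρ S) →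
    ∃ π : WilesPseudoRep (absoluteGaloisGroup ℚ) (heckeAlgebraOfTypeSigma p k Ō ρ S) c,
      ∀ σ : absoluteGaloisGroup ℚ,
        ((π.tr σ : heckeAlgebraOfTypeSigma p k Ō ρ S) :
            O × (modularLiftsOfTypeSigma p k Ō ρ S → Ō)) = traceTuple p k Ō ρ S σ

/-! ### G2 — `T_Σ` is local and `π_f` detects units (DDT p. 94 "complete noetherian local") -/

/-- **G2a.** Every `t ∈ T_Σ` has all its `Ō`-coordinates congruent to (the image of) its
`f`-coordinate `π_f(t)` modulo `𝔪_Ō` — from the congruence clause (ii) of `N_Σ`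
(`charpoly ρ' ≡ charpoly ρ`) on the generators `T_σ`, by `Algebra.adjoin_induction`.
[cite: DarmonDiamondTaylor1995, §3.3, p. 94 ("with residue field k")] -/
theorem sigG2a (t : O × (modularLiftsOfTypeSigma p k Ō ρ S → Ō))
    (ht : t ∈ heckeAlgebraOfTypeSigma p k Ō ρ S) (ρ' : modularLiftsOfTypeSigma p k Ō ρ S) :
    t.2 ρ' - algebraMap O Ō t.1 ∈ maximalIdeal Ō := by
  induction ht using Algebra.adjoin_induction with
  | mem y hy =>
    obtain ⟨σ, -, rfl⟩ := hy
    rw [traceTuple_fst, traceTuple_snd_apply]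
    have h := (mem_modularLiftsOfTypeSigma_iff.mp ρ'.2).2.1 σ 1
    have e1 : FramedRep.trace (ρ' : FramedGaloisRep ℚ Ō 2) σ =
        -((FramedRep.charpoly (ρ' : FramedGaloisRep ℚ Ō 2) σ).coeff 1) := by
      simp [FramedRep.trace, FramedRep.charpoly, Matrix.trace_eq_neg_charpoly_coeff]
    have e2 : FramedRep.trace ρ σ = -((FramedRep.charpoly ρ σ).coeff 1) := by
      simp [FramedRep.trace, FramedRep.charpoly, Matrix.trace_eq_neg_charpoly_coeff]
    rw [e1, e2, map_neg, neg_sub_neg]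
    rw [← Ideal.neg_mem_iff, neg_sub] at h
    exact h
  | algebraMap r => simp
  | add y z _ _ hy hz =>
    have := add_mem hy hz
    convert this using 1
    rw [Prod.fst_add, Prod.snd_add, Pi.add_apply, map_add]; ring
  | mul y z _ _ hy hz =>
    have := add_mem (Ideal.mul_mem_left _ (y.2 ρ') hz)
      (Ideal.mul_mem_left _ (algebraMap O Ō z.1) hy)
    convert this using 1
    rw [Prod.fst_mul, Prod.snd_mul, Pi.mul_apply, map_mul]; ring

/-- **G2b (helper signature).** If `O` is local and `T_Σ` is inverse-closed in `T̃_Σ` (true when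
`T_Σ` is module-finite over `O` — DDT p. 94 "finitely generated free `O`-module", via
Carayol–Livné finiteness of `N_Σ`; FALSE for the literal infinite product without it, hence a
hypothesis), then `T_Σ` is a local ring and the augmentation `π_f` is a local homomorphism:
`t` is a unit iff `π_f(t) ∈ O×` (by G2a every `Ō`-coordinate is then `≡` a unit mod `𝔪_Ō`).
[cite: DarmonDiamondTaylor1995, §3.3, p. 94] -/
def SigG2b [IsLocalRing O] : Prop :=
  (∀ t : heckeAlgebraOfTypeSigma p k Ō ρ S,
      IsUnit (t : O × (modularLiftsOfTypeSigma p k Ō ρ S → Ō)) → IsUnit t) →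
    IsLocalRing (heckeAlgebraOfTypeSigma p k Ō ρ S) ∧
      IsLocalHom (heckeAlgebraOfTypeSigma.augmentation p k Ō ρ S)

/-- `π_f` detects units of `T̃_Σ`-coordinates: if `π_f(t) ∈ O×` then `t` is a unit of the ambient
`T̃_Σ` (each `Ō`-coordinate is `≡` a unit mod `𝔪_Ō`, G2a). [folklore] -/
theorem isUnit_coe_of_isUnit_augmentation (t : heckeAlgebraOfTypeSigma p k Ō ρ S)
    (ht : IsUnit (heckeAlgebraOfTypeSigma.augmentation p k Ō ρ S t)) :
    IsUnit (t : O × (modularLiftsOfTypeSigma p k Ō ρ S → Ō)) := by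
  rw [heckeAlgebraOfTypeSigma.augmentation_apply] at ht
  refine Prod.isUnit_iff.mpr ⟨ht, Pi.isUnit_iff.mpr fun ρ' => ?_⟩
  by_contra hx
  have hxm : (t : O × (modularLiftsOfTypeSigma p k Ō ρ S → Ō)).2 ρ' ∈ maximalIdeal Ō :=
    (IsLocalRing.mem_maximalIdeal _).mpr hx
  have hd := sigG2a p k Ō ρ S _ t.2 ρ'
  have hy : algebraMap O Ō (t : O × (modularLiftsOfTypeSigma p k Ō ρ S → Ō)).1 ∈
      maximalIdeal Ō := by
    have := sub_mem hxm hd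
    rwa [sub_sub_cancel] at this
  exact (IsLocalRing.mem_maximalIdeal _).mp hy (ht.map (algebraMap O Ō))

/-- **G2b holds** (PROVED from the inverse-closedness hypothesis). [cite: DarmonDiamondTaylor1995, §3.3, p. 94] -/
theorem sigG2b [IsLocalRing O] : SigG2b p k Ō ρ S := by
  intro hinv
  have key : ∀ t : heckeAlgebraOfTypeSigma p k Ō ρ S,
      IsUnit (heckeAlgebraOfTypeSigma.augmentation p k Ō ρ S t) → IsUnit t :=
    fun t ht => hinv t (isUnit_coe_of_isUnit_augmentation p k Ō ρ S t ht)
  have hnt : Nontrivial (heckeAlgebraOfTypeSigma p k Ō ρ S) :=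
    (heckeAlgebraOfTypeSigma.augmentation p k Ō ρ S).toRingHom.domain_nontrivial
  refine ⟨IsLocalRing.of_isUnit_or_isUnit_of_isUnit_add fun {a b} hab => ?_, ⟨fun t ht => key t ht⟩⟩
  have h := hab.map (heckeAlgebraOfTypeSigma.augmentation p k Ō ρ S)
  rw [map_add] at h
  rcases IsLocalRing.isUnit_or_isUnit_of_isUnit_add h with ha | hb
  · exact Or.inl (key a ha)
  · exact Or.inr (key b hb)

/-! ### G3 — "by the irreducibility of `ρ̄` we can find some `e = b(σ)c(τ) ∈ T_Σ×`" (DDT p. 95) -/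

/-- **G3 (helper signature; abstract Wiles–Hida).** Over a local ring `A`, let
`ρ₀ : G →* M₂(A)` be `c`-adapted (`ρ₀(c) = diag(-1,1)`) with residual representation
`ρ̄₀ : G → GL₂(A/𝔪)` absolutely irreducible.  Then some `x(r,s) = b(r)c(s)` of the pseudo-
representation `ofRep ρ₀` is a unit: otherwise all `b̄(r)c̄(s) = 0` in the residue FIELD, so
`b̄ ≡ 0` or `c̄ ≡ 0`, and `ρ̄₀` fixes a coordinate line — reducible.
[cite: Hida2000, Prop. 2.16 (p. 85) and proof of Thm. 3.29 (p. 160)] [cite: Wiles1988, §2.2, Lemma 2.2.3] -/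
def SigG3 : Prop :=
  ∀ {G : Type u'} [Group G] {A : Type v'} [CommRing A] [IsLocalRing A] {c : G}
    (ρ₀ : G →* Matrix (Fin 2) (Fin 2) A) (hc : ρ₀ c = !![-1, 0; 0, 1]),
    IsAbsIrreducible ((Matrix.GeneralLinearGroup.map (residue A)).comp ρ₀.toHomUnits) →
      ∃ r s : G, IsUnit ((WilesPseudoRep.ofRep ρ₀ hc).x r s)

/-! ### G4 — DDT Lemma 3.27, representation clause: `ρ^mod_Σ : G_ℚ → GL₂(T_Σ)` -/

/-- **G4 (assembly target = DDT Lemma 3.27, representation clause).** For `O` local with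
`2 ∈ O×`, `ρ : G_ℚ → GL₂(O)` odd and residually absolutely irreducible, all trace tuples in `T_Σ`
(G0) and `T_Σ` inverse-closed in `T̃_Σ` (G2b), there is `ρ^mod_Σ : G_ℚ →* GL₂(T_Σ)` with
`tr ρ^mod_Σ(σ) = T_σ` for every `σ`, `ρ^mod_Σ(c) = diag(-1,1)`, and continuous matrix entries.
Route: `Π` from G1; its `π_f`-pushforward is `ofRep` of an adapted conjugate of `ρ`
(`ofTraceFamily_map`), so by G3 some `π_f(Π.x r s) ∈ O×`, hence `Π.x r s ∈ T_Σ×` by G2b; then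
`Π.toGL r s u` (`WilesPseudoRep.toGL`, `trace_toRep`, `toRep_c`, `continuous_toRep`).  This is
the hinge defining `φ_Σ : R_Σ ↠ T_Σ` (surjective because `T_Σ` is `Algebra.adjoin` of traces).
[cite: DarmonDiamondTaylor1995, Lemma 3.27 (pp. 94–95)] [cite: Wiles1995, §2.3 / Prop. 2.15] -/
def SigG4 [IsLocalRing O] [IsTopologicalRing O] [IsTopologicalRing Ō] : Prop :=
  IsUnit (2 : O) → ∀ (φ : ℚ →+* ℝ) (c : absoluteGaloisGroup ℚ), IsComplexConjugation φ c →
    ρ.IsOdd →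
    IsAbsIrreducible ((Matrix.GeneralLinearGroup.map (residue O)).comp
      (ρ : absoluteGaloisGroup ℚ →* GL (Fin 2) O)) →
    (∀ σ : absoluteGaloisGroup ℚ, traceTuple p k Ō ρ S σ ∈ heckeAlgebraOfTypeSigma p k Ō ρ S) →
    (∀ t : heckeAlgebraOfTypeSigma p k Ō ρ S,
      IsUnit (t : O × (modularLiftsOfTypeSigma p k Ō ρ S → Ō)) → IsUnit t) →
    ∃ ρmod : absoluteGaloisGroup ℚ →* GL (Fin 2) (heckeAlgebraOfTypeSigma p k Ō ρ S),
      (∀ σ : absoluteGaloisGroup ℚ,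
        ((((ρmod σ : GL (Fin 2) (heckeAlgebraOfTypeSigma p k Ō ρ S)) :
            Matrix (Fin 2) (Fin 2) (heckeAlgebraOfTypeSigma p k Ō ρ S)).trace :
            heckeAlgebraOfTypeSigma p k Ō ρ S) :
          O × (modularLiftsOfTypeSigma p k Ō ρ S → Ō)) = traceTuple p k Ō ρ S σ) ∧
      ((ρmod c : GL (Fin 2) (heckeAlgebraOfTypeSigma p k Ō ρ S)) :
          Matrix (Fin 2) (Fin 2) (heckeAlgebraOfTypeSigma p k Ō ρ S)) = !![-1, 0; 0, 1] ∧
      Continuous fun σ : absoluteGaloisGroup ℚ =>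
        ((ρmod σ : GL (Fin 2) (heckeAlgebraOfTypeSigma p k Ō ρ S)) :
          Matrix (Fin 2) (Fin 2) (heckeAlgebraOfTypeSigma p k Ō ρ S))

end Summit.ABC.ABC.Cruxes.FreyModularity.Sketch.StubIdeas1g7

end
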